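import Summits.BirchSwinnertonDyer.BirchSwinnertonDyer.Theorems.GenusKolyvaginAtTwoGenusPrimitiveSupplyAtTwoPrimeHeegnerTwinInert
import Summits.BirchSwinnertonDyer.BirchSwinnertonDyer.Theorems.GenusKolyvaginAtTwoGenusPrimitiveSupplyAtTwoPrimeHeegnerTwinUnramified
import HarnessLib

/-!
# Route `GenusKolyvaginAtTwo`, crux #2 `GenusPrimitiveSupplyAtTwo` (stmt-BirchSwinnertonDyer-22136):
# the `Δ < 0` DEF = 1 supply with `2` INERT — prime Heegner fields `ℚ(√−ℓ)`, `ℓ ≡ 3 (mod 8)`, for curves good at `2`,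
# UNCONDITIONALLY and with NO Galois-image hypothesis

Width seat `bsd-line-gk2-p5` g12 (cell `bsd-f1-sign2`, SUPPLY lineage), file 49 of the series: the `Δ < 0` companion of
`…PrimeHeegnerTwinInert` (§107–§109, `Δ > 0`), on top of `…PrimeHeegnerTwinUnramified` (§104 `cor34i_twin_prime_heegner_unramified`: the
prime Heegner twin law with `2` split or inert, no `ρ̄₂`-onto). THEOREMS ONLY (no definition, no named fact, no `sorry`, no local instance);
helper `--supports stmt-BirchSwinnertonDyer-22136`; no item is closed; BSD is not proved by any of this.

WHAT. The lineage's `Δ < 0` supply theorems `GenusKolyTwin.supply_DEF1_of_strict_free_prime` / `supply_DEF1_of_not_strict_prime(_of_duality)`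
take `ℓ ≡ 7 (mod 8)` (so that `2` splits in `K`) and, in their unconditional forms, `ρ̄_{W,2}` onto. For curves with `2 ∤ N_W` both go:

* §110 **`supply_DEF1_negDisc_inert_of_card_eq_one`** — `Δ_W < 0`, `#Sel₂(W) = 1`, `2 ∤ N_W`, `ℓ ≡ 3 (mod 8)` prime `≠ 3` with
  `ℓ ≡ −1 (mod p)` for every odd `p ∣ N_W` ⟹ `K = ℚ(√−ℓ)` carries every K-clause of crux 22136 with `2` NOT split, `ℓ` is a `T`-prime
  (exactly one root of the `2`-division cubic mod `ℓ`: DEF(W,K) = 1), and a GLOBALLY MINIMAL twin `Wd ≅ W^{(−ℓ)}` has `#Sel₂(Wd) = 2`;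
* §111 **`supply_DEF1_negDisc_inert_of_not_strict`** — the same on `#Sel₂(W) = 4` for `ℓ` at which `Sel₂(W)` is NOT strict
  (`¬ Sel₂(W) ≤ strictLocalKer W ℚ_ℓ 2`), and `no_minimalTwin_negDisc_inert_of_strict` — at a strict `ℓ` the twin has `#Sel₂ = 8`.

Honest framing: supply statements of the route's UP lane widened to `2`-inert fields (Mazur's norm theorem at `2` through the master
datum); the existence of such primes (Čebotarev) and the twin's analytic rank are NOT asserted; (U) 24947 / (CONV₂) 19220 untouched;
beyond-print theorem: no; BSD is not proved by any of this.

References: [MazurRubin2010] Thm. 2.7, Lemmas 2.9–2.11, Prop. 3.3, Cor. 3.4 (i); [Kramer1981] Thm. 1, Props. 3, 7; [Mazur1972] Cor. 4.4;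
[GrossLMS1991] §1 (p. 235).
-/

set_option linter.dupNamespace false -- tree convention: `Summit.BirchSwinnertonDyer.BirchSwinnertonDyer.Theorems` (summit = sub-problem)
set_option autoImplicit false

noncomputable section

open scoped Classical

open NumberField WeierstrassCurve Literature.NumberTheory.EllipticCurves Literature.NumberTheory.QuadraticFields
open Summit.BirchSwinnertonDyer.Rank1Residual.F1Sign2

namespace Summit.BirchSwinnertonDyer.BirchSwinnertonDyer.Theorems.GenusKolyTwin

variable (W : WeierstrassCurve ℚ) [W.IsElliptic] [W.IsGloballyMinimal]

/-! ## §110 `{Δ < 0, #Sel₂(E) = 1, 2 ∤ N}`: every `ℓ ≡ 3 (mod 8)` prime Heegner field supplies a Sel₂-minimal twin -/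

/-- **SUPPLY″-Selmer on `{Δ_W < 0, #Sel₂(W) = 1, 2 ∤ N_W}` with `2` INERT — UNCONDITIONAL, no image hypothesis.** `W/ℚ` globally minimal
elliptic with `Δ_W < 0`, `#Sel₂(W) = 1`, `2 ∤ N_W`; `ℓ ≡ 3 (mod 8)` a prime `≠ 3` with `ℓ ≡ −1 (mod p)` for every odd `p ∣ N_W` ⟹
`K = ℚ(√−ℓ)` is imaginary quadratic with `d_K = −ℓ` odd `≠ −3`, Heegner for `N_W`, `2` not split, the two non-square clauses, `ℓ` is a
`T`-prime (exactly one root of the `2`-division cubic mod `ℓ`), and a GLOBALLY MINIMAL twin `Wd ≅ W^{(−ℓ)}` has `#Sel₂(Wd) = 2` (`Sel₂(W) = 0`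
is strict at `ℓ`: UP). The `2`-inert companion of `supply_DEF1_of_strict_free_prime`.
[cite: MazurRubin2010, Thm. 2.7, Lemma 2.10 (v), Cor. 3.4 (i)] [cite: Mazur1972, Cor. 4.4] [cite: GrossLMS1991, §1 (p. 235)] -/
theorem supply_DEF1_negDisc_inert_of_card_eq_one (hΔ : W.Δ < 0) (h1 : Nat.card (W.selmerGroup 2) = 1)
    (h2N : ¬ 2 ∣ W.conductorNorm ℤ) {ℓ : ℕ} [Fact ℓ.Prime] (hℓ8 : ℓ % 8 = 3) (hℓ3 : ℓ ≠ 3)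
    (hℓN : ∀ p : ℕ, p.Prime → p ∣ W.conductorNorm ℤ → p ≠ 2 → (ℓ : ZMod p) = -1) :
    ∃ (K : Type) (_ : Field K) (_ : NumberField K), IsImaginaryQuadratic K ∧ discr K = -(ℓ : ℤ) ∧ Odd (discr K) ∧
      discr K ≠ -3 ∧ SatisfiesHeegnerHypothesis (W.conductorNorm ℤ) K ∧
      ¬ IsSquare ((discr K : ℚ) * -|W.Δ|) ∧ ¬ IsSquare ((discr K : ℚ) * (-(2 * |W.Δ|))) ∧
      ((Ideal.span {(2 : ℤ)}).primesOver (𝓞 K)).ncard ≠ 2 ∧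
      (∃! x : ZMod ℓ, 4 * x ^ 3 + ((integralModelInt W).b₂ : ZMod ℓ) * x ^ 2 +
        2 * ((integralModelInt W).b₄ : ZMod ℓ) * x + ((integralModelInt W).b₆ : ZMod ℓ) = 0) ∧
      ∃ (Wd : WeierstrassCurve ℚ) (_ : Wd.IsElliptic) (_ : Wd.IsGloballyMinimal),
        (∃ C : VariableChange ℚ, C • W.quadraticTwist (discr K : ℚ) = Wd) ∧ Nat.card (Wd.selmerGroup 2) = 2 := by
  have hℓ : ℓ.Prime := Fact.out
  obtain ⟨-, -, K, _, _, hK, hd, hodd, hd3, hH, h2K, hsq1, hsq2⟩ := exists_heegnerField_of_prime_inert W hℓ hℓ8 hℓ3 h2N hℓN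
  have hd0 : ((discr K : ℤ) : ℚ) ≠ 0 := by exact_mod_cast NumberField.discr_ne_zero K
  haveI := W.isElliptic_quadraticTwist hd0
  obtain ⟨C, hC⟩ := hasGlobalMinimalModel_rat_holds (W.quadraticTwist ((discr K : ℤ) : ℚ))
  haveI := hC
  refine ⟨K, inferInstance, inferInstance, hK, hd, hodd, hd3, hH, hsq1, hsq2, h2K,
    existsUnique_zmod_root_of_discr_eq_neg_prime_of_Δ_neg W hK hodd hH hd hΔ,
    C • W.quadraticTwist ((discr K : ℤ) : ℚ), inferInstance, hC, ⟨C, rfl⟩, ?_⟩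
  exact natCard_selmerGroup_twin_eq_two_unramified W hΔ hK hodd hH hd _ ⟨C, rfl⟩ h1

/-! ## §111 `{Δ < 0, #Sel₂(E) = 4, 2 ∤ N}`: the twin at `ℚ(√−ℓ)`, `ℓ ≡ 3 (mod 8)`, is minimal iff `Sel₂(E)` is not strict at `ℓ` -/

/-- **SUPPLY″-Selmer on `{Δ_W < 0, #Sel₂(W) = 4, 2 ∤ N_W}` at a NON-STRICT `ℓ ≡ 3 (mod 8)` — UNCONDITIONAL, no image hypothesis.**
Data as in §110 with `#Sel₂(W) = 4` and `¬ Sel₂(W) ≤ strictLocalKer W ℚ_ℓ 2` (some `2`-Selmer class has `loc_ℓ ≠ 0`): the same `K` and a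
globally minimal twin with `#Sel₂(Wd) = 2` (DOWN). The `2`-inert companion of `supply_DEF1_of_not_strict_prime`.
[cite: MazurRubin2010, Lemmas 2.10 (v), 2.11, Prop. 3.3, Cor. 3.4 (i)] [cite: Mazur1972, Cor. 4.4] [cite: GrossLMS1991, §1 (p. 235)] -/
theorem supply_DEF1_negDisc_inert_of_not_strict (hΔ : W.Δ < 0) (h4 : Nat.card (W.selmerGroup 2) = 4)
    (h2N : ¬ 2 ∣ W.conductorNorm ℤ) {ℓ : ℕ} [Fact ℓ.Prime] (hℓ8 : ℓ % 8 = 3) (hℓ3 : ℓ ≠ 3)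
    (hℓN : ∀ p : ℕ, p.Prime → p ∣ W.conductorNorm ℤ → p ≠ 2 → (ℓ : ZMod p) = -1)
    (hns : ¬ W.selmerGroup 2 ≤ MazurRubin2010.strictLocalKer W ℚ_[ℓ] 2) :
    ∃ (K : Type) (_ : Field K) (_ : NumberField K), IsImaginaryQuadratic K ∧ discr K = -(ℓ : ℤ) ∧ Odd (discr K) ∧
      discr K ≠ -3 ∧ SatisfiesHeegnerHypothesis (W.conductorNorm ℤ) K ∧
      ¬ IsSquare ((discr K : ℚ) * -|W.Δ|) ∧ ¬ IsSquare ((discr K : ℚ) * (-(2 * |W.Δ|))) ∧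
      ((Ideal.span {(2 : ℤ)}).primesOver (𝓞 K)).ncard ≠ 2 ∧
      (∃! x : ZMod ℓ, 4 * x ^ 3 + ((integralModelInt W).b₂ : ZMod ℓ) * x ^ 2 +
        2 * ((integralModelInt W).b₄ : ZMod ℓ) * x + ((integralModelInt W).b₆ : ZMod ℓ) = 0) ∧
      ∃ (Wd : WeierstrassCurve ℚ) (_ : Wd.IsElliptic) (_ : Wd.IsGloballyMinimal),
        (∃ C : VariableChange ℚ, C • W.quadraticTwist (discr K : ℚ) = Wd) ∧ Nat.card (Wd.selmerGroup 2) = 2 := by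
  have hℓ : ℓ.Prime := Fact.out
  obtain ⟨-, -, K, _, _, hK, hd, hodd, hd3, hH, h2K, hsq1, hsq2⟩ := exists_heegnerField_of_prime_inert W hℓ hℓ8 hℓ3 h2N hℓN
  have hd0 : ((discr K : ℤ) : ℚ) ≠ 0 := by exact_mod_cast NumberField.discr_ne_zero K
  haveI := W.isElliptic_quadraticTwist hd0
  obtain ⟨C, hC⟩ := hasGlobalMinimalModel_rat_holds (W.quadraticTwist ((discr K : ℤ) : ℚ))
  haveI := hC
  refine ⟨K, inferInstance, inferInstance, hK, hd, hodd, hd3, hH, hsq1, hsq2, h2K,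
    existsUnique_zmod_root_of_discr_eq_neg_prime_of_Δ_neg W hK hodd hH hd hΔ,
    C • W.quadraticTwist ((discr K : ℤ) : ℚ), inferInstance, hC, ⟨C, rfl⟩, ?_⟩
  exact (natCard_selmerGroup_twin_eq_two_iff_not_strict_unramified W hΔ hK hodd hH hd _ ⟨C, rfl⟩ h4).mpr hns

/-- **At a STRICT `ℓ` the twin is not minimal** (`Δ_W < 0`, `#Sel₂(W) = 4`, `K` a prime Heegner field with `d_K = −ℓ` odd, `2` split or
inert): `Sel₂(W) ≤ strictLocalKer W ℚ_ℓ 2` ⟹ `#Sel₂(Wd) = 8` for every elliptic model `Wd ≅ W^{(−ℓ)}` (UP). Unconditional.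
[cite: MazurRubin2010, Thm. 2.7, Cor. 3.4 (i)] -/
theorem no_minimalTwin_negDisc_of_strict {K : Type} [Field K] [NumberField K]
    (hΔ : W.Δ < 0) (hK : IsImaginaryQuadratic K) (hodd : Odd (discr K))
    (hH : SatisfiesHeegnerHypothesis (W.conductorNorm ℤ) K)
    {ℓ : ℕ} [Fact ℓ.Prime] (hd : discr K = -(ℓ : ℤ)) (Wd : WeierstrassCurve ℚ) [Wd.IsElliptic]
    (hWd : ∃ C : VariableChange ℚ, C • W.quadraticTwist (discr K : ℚ) = Wd)
    (h4 : Nat.card (W.selmerGroup 2) = 4) (hs : W.selmerGroup 2 ≤ MazurRubin2010.strictLocalKer W ℚ_[ℓ] 2) :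
    Nat.card (Wd.selmerGroup 2) = 8 := by
  have h := (cor34i_twin_prime_heegner_unramified W hΔ hK hodd hH hd Wd hWd).1 hs
  omega

end Summit.BirchSwinnertonDyer.BirchSwinnertonDyer.Theorems.GenusKolyTwin

end
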